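import Summits.CriticalPhenomena.SAWScalingLimit.Theorems.SAWTensorRGRestrictionOfLimitRadoFree
import Literature.Probability.RandomPlanarGeometry.NestedJordanFreeOrder
import HarnessLib

/-!
# Radó squeezes, part 3: the defect side of a free arc (Newman's cross-cut theorem)

Support file (`--supports stmt-CriticalPhenomena-0773`, towards the registered stub `stub_radoSqueezeFamily`,
geometry F′ of the line `birth` for the crux `RestrictionOfLimit`). Pure plane topology.

Let `D' ⊆ D` be Dobrushin domains with common marked points and `ᾱ = D'.boundary '' [θ₁, θ₂]` the closed free
arc of a free parameter `x` of the window (part 2): a cross-cut of `D` from `P` to `Q`. By Newman's cross-cut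
theorem (tree, discharged) `D ∖ ᾱ = U ⊔ U'` with `U, U'` open connected, `frontier U = ᾱ ∪ β`,
`frontier U' = ᾱ ∪ β'` for the two arcs `β = D.boundary '' [s, t]`, `β' = D.boundary '' [t, s + 1]` of `∂D`
between `P` and `Q`; we call `U`, the side NOT containing the connected set `D'`, the DEFECT SIDE of the free arc
(`exists_sides`). We record: `U ∩ closure D' = ∅`; `β ∩ closure D' ⊆ {P, Q}`; `β` is a simple arc from `P` to
`Q`; near every point of `β` other than `P, Q` the domain `D` coincides with `U` (`side_nhds`); and the closures
of the defect sides of two distinct free arcs meet at most in `{P, Q}` (`closure_sides_inter`). All hypotheses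
on the sides are carried explicitly (no definition is introduced).

References: M. H. A. Newman, *Elements of the topology of plane sets of points* (1939), Ch. V §11,
Thms 11·7–11·8. Axioms `propext`, `Classical.choice`, `Quot.sound`; Newman's theorem and the Jordan curve
theorem only through the discharged `Newman1939_crosscut_holds`.
-/

noncomputable section

open Set Filter Topology Metric
open Literature.Topology.PlaneTopology Literature.Probability.RandomPlanarGeometry

namespace Summit.CriticalPhenomena.SAWScalingLimit.Theorems.RestrictionOfLimit.Birth

section Sides


/-- Arcs of a boundary loop shifted by a period. [folklore] -/
theorem image_boundary_Icc_add_one (E : JordanDomain) (u v : ℝ) :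
    E.boundary '' Icc (u + 1) (v + 1) = E.boundary '' Icc u v := by
  rw [← image_add_const_Icc, image_image]
  exact image_congr fun y _ ↦ E.periodic_boundary y

/-- **The two sides of a closed free arc** (Newman's cross-cut theorem): `D ∖ ᾱ = U ⊔ U'` with `U, U'` open
connected, `frontier U = ᾱ ∪ D.boundary '' [s, t]`, `frontier U' = ᾱ ∪ D.boundary '' [t, s + 1]`
(`s < t < s + 1`, `{D.boundary s, D.boundary t} = {P, Q}`), and `D' ⊆ U'`. [cite: Newman1939, Ch. V §11] -/
theorem exists_sides {D D' : DobrushinDomain} {F : Set ℝ} (hF : F = {θ : ℝ | D'.boundary θ ∈ D.carrier})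
    (hsub : D'.carrier ⊆ D.carrier) (h0 : D'.pt 0 = D.pt 0) (h1 : D'.pt 1 = D.pt 1) {x : ℝ} (hx : x ∈ F)
    (hxw : x ∈ Ioo (D'.mark 0) (D'.mark 0 + 1)) :
    ∃ (U U' : Set ℂ) (s t : ℝ), s < t ∧ t < s + 1 ∧ IsOpen U ∧ IsOpen U' ∧
    IsConnected U ∧ IsConnected U' ∧ Disjoint U U' ∧ U ∪ U' = D.carrier \ (D'.boundary '' Icc (sInf
        (connectedComponentIn F x)) (sSup (connectedComponentIn F x))) ∧
    frontier U = (D'.boundary '' Icc (sInf (connectedComponentIn F x)) (sSup (connectedComponentIn F x))) ∪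
        D.boundary '' Icc s t ∧ frontier U' = (D'.boundary '' Icc (sInf (connectedComponentIn F x)) (sSup
        (connectedComponentIn F x))) ∪ D.boundary '' Icc t (s + 1) ∧
    D'.carrier ⊆ U' ∧ ((D.boundary s = (D'.boundary (sInf (connectedComponentIn F x))) ∧ D.boundary t =
        (D'.boundary (sSup (connectedComponentIn F x)))) ∨ (D.boundary s = (D'.boundary (sSup
        (connectedComponentIn F x))) ∧ D.boundary t = (D'.boundary (sInf (connectedComponentIn F x))))) := by
  obtain ⟨hPfr, hQfr, -, -, hPQ⟩ := free_endpoints hF hsub h0 h1 hx hxw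
  have hcross := free_isCrosscut hF hsub h0 h1 hx hxw
  rw [← D.range_boundary] at hPfr hQfr
  obtain ⟨s₀, hs₀⟩ := hPfr
  obtain ⟨t₀, ht₀⟩ := hQfr
  set t : ℝ := s₀ + Int.fract (t₀ - s₀) with ht_def
  have hqt : D.boundary t = D.boundary t₀ := by
    rw [ht_def, Int.fract, show s₀ + (t₀ - s₀ - (⌊t₀ - s₀⌋ : ℝ)) = t₀ - (⌊t₀ - s₀⌋ : ℝ) * 1 by ring]
    exact D.periodic_boundary.sub_int_mul_eq ⌊t₀ - s₀⌋
  have hst : s₀ < t := by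
    rcases (Int.fract_nonneg (t₀ - s₀)).lt_or_eq with h | h
    · rw [ht_def]; linarith
    · exfalso
      apply hPQ
      rw [← hs₀, ← ht₀, ← hqt, ht_def, ← h, add_zero]
  have hts : t < s₀ + 1 := by rw [ht_def]; linarith [Int.fract_lt_one (t₀ - s₀)]
  have hcross' : D.IsCrosscut (D'.boundary '' Icc (sInf (connectedComponentIn F x)) (sSup (connectedComponentIn F
      x))) (D.boundary s₀) (D.boundary t) := by rwa [hs₀, hqt, ht₀]
  obtain ⟨U₁, U₂, ho₁, ho₂, hc₁, hc₂, hdisj, hunion, hfr₁, hfr₂⟩ :=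
    Newman1939_crosscut_holds D.toJordanDomain _ s₀ t hst hts hcross'
  have hD'sub : D'.carrier ⊆ U₁ ∪ U₂ := by
    rw [hunion]
    refine fun z hz ↦ ⟨hsub hz, ?_⟩
    rintro ⟨θ, -, hθz⟩
    exact D'.toJordanDomain.boundary_notMem_carrier θ (hθz ▸ hz)
  rcases D'.isConnected.isPreconnected.subset_or_subset ho₁ ho₂ hdisj hD'sub with h | h
  · refine ⟨U₂, U₁, t, s₀ + 1, hts, by linarith, ho₂, ho₁, hc₂, hc₁, hdisj.symm, ?_, hfr₂, ?_, h, ?_⟩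
    · rw [union_comm, hunion]
    · rw [hfr₁, image_boundary_Icc_add_one]
    · right
      rw [D.periodic_boundary, hs₀, hqt, ht₀]
      exact ⟨rfl, rfl⟩
  · refine ⟨U₁, U₂, s₀, t, hst, hts, ho₁, ho₂, hc₁, hc₂, hdisj, hunion, hfr₁, hfr₂, h, ?_⟩
    left
    rw [hs₀, hqt, ht₀]
    exact ⟨rfl, rfl⟩

/-- The defect side lies in `D`. [folklore] -/
theorem side_subset {D D' : DobrushinDomain} {F : Set ℝ} {x : ℝ} {U U' : Set ℂ}
    (hunion : U ∪ U' = D.carrier \ (D'.boundary '' Icc (sInf (connectedComponentIn F x)) (sSup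
        (connectedComponentIn F x)))) : U ⊆ D.carrier :=
  fun z hz ↦ ((hunion ▸ Or.inl hz : z ∈ D.carrier \ (D'.boundary '' Icc (sInf (connectedComponentIn F x)) (sSup
      (connectedComponentIn F x))))).1

/-- **The defect side misses the closure of `D'`.** [folklore] -/
theorem side_inter_closure {D' : DobrushinDomain} {U U' : Set ℂ} (hUo : IsOpen U) (hdisj : Disjoint U U')
    (hD'U : D'.carrier ⊆ U') : U ∩ closure D'.carrier = ∅ :=
  ((hdisj.mono_right hD'U).closure_right hUo).inter_eq

/-- The closed free arc meets `∂D` at most in `{P, Q}`. [folklore] -/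
theorem alpha_inter_beta {D D' : DobrushinDomain} {F : Set ℝ} (hF : F = {θ : ℝ | D'.boundary θ ∈ D.carrier})
    (hsub : D'.carrier ⊆ D.carrier) (h0 : D'.pt 0 = D.pt 0) (h1 : D'.pt 1 = D.pt 1) {x : ℝ} (hx : x ∈ F)
    (hxw : x ∈ Ioo (D'.mark 0) (D'.mark 0 + 1)) (u v : ℝ) : (D'.boundary '' Icc (sInf (connectedComponentIn F x))
        (sSup (connectedComponentIn F x))) ∩ D.boundary '' Icc u v ⊆ ({(D'.boundary (sInf (connectedComponentIn F
        x))), (D'.boundary (sSup (connectedComponentIn F x)))} : Set ℂ) := by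
  rintro z ⟨hzα, ⟨u', -, rfl⟩⟩
  by_contra hzn
  exact D.toJordanDomain.boundary_notMem_carrier u'
    ((free_isCrosscut hF hsub h0 h1 hx hxw).2.2.2.2 ⟨hzα, hzn⟩)

/-- The two arcs of `∂D` between `D.boundary s` and `D.boundary t` meet only at their end-points. [folklore] -/
theorem beta_inter_beta' (E : JordanDomain) {s t : ℝ} (hst : s < t) (hts : t < s + 1) :
    E.boundary '' Icc s t ∩ E.boundary '' Icc t (s + 1) ⊆ ({E.boundary s, E.boundary t} : Set ℂ) := by
  rintro z ⟨⟨u, hu, rfl⟩, ⟨v, hv, huv⟩⟩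
  rcases hv.2.lt_or_eq with hlt | heq
  · have := E.injOn_boundary_Ico s ⟨hu.1, by linarith [hu.2]⟩ ⟨by linarith [hv.1], hlt⟩ huv.symm
    right
    rw [mem_singleton_iff, show u = t by linarith [hv.1, hu.2]]
  · left
    rw [← huv, heq]
    exact E.periodic_boundary s

/-- **The arc `β` meets `closure D'` at most in `{P, Q}`** (so the open arc `β ∖ {P, Q}` carries no point of
`∂D'`, in particular neither marked point). [folklore] -/
theorem beta_inter_closure {D D' : DobrushinDomain} {F : Set ℝ} (hF : F = {θ : ℝ | D'.boundary θ ∈ D.carrier})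
    (hsub : D'.carrier ⊆ D.carrier) (h0 : D'.pt 0 = D.pt 0) (h1 : D'.pt 1 = D.pt 1) {x : ℝ} (hx : x ∈ F)
    (hxw : x ∈ Ioo (D'.mark 0) (D'.mark 0 + 1)) {U U' : Set ℂ} {s t : ℝ} (hst : s < t) (hts : t < s + 1)
    (hunion : U ∪ U' = D.carrier \ (D'.boundary '' Icc (sInf (connectedComponentIn F x)) (sSup
        (connectedComponentIn F x)))) (hfrU' : frontier U' = (D'.boundary '' Icc (sInf (connectedComponentIn F
        x)) (sSup (connectedComponentIn F x))) ∪ D.boundary '' Icc t (s + 1))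
    (hD'U : D'.carrier ⊆ U')
    (hends : (D.boundary s = (D'.boundary (sInf (connectedComponentIn F x))) ∧ D.boundary t = (D'.boundary (sSup
        (connectedComponentIn F x)))) ∨ (D.boundary s = (D'.boundary (sSup (connectedComponentIn F x))) ∧
        D.boundary t = (D'.boundary (sInf (connectedComponentIn F x))))) :
    D.boundary '' Icc s t ∩ closure D'.carrier ⊆ ({(D'.boundary (sInf (connectedComponentIn F x))), (D'.boundary
        (sSup (connectedComponentIn F x)))} : Set ℂ) := by
  rintro z ⟨hzβ, hzcl⟩
  have hzcl' : z ∈ closure U' := closure_mono hD'U hzcl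
  rw [closure_eq_self_union_frontier, hfrU'] at hzcl'
  rcases hzcl' with hzU' | hzα | hzβ'
  · exfalso
    obtain ⟨u, -, rfl⟩ := hzβ
    exact D.toJordanDomain.boundary_notMem_carrier u ((hunion ▸ Or.inr hzU' : D.boundary u ∈ D.carrier \
        (D'.boundary '' Icc (sInf (connectedComponentIn F x)) (sSup (connectedComponentIn F x))))).1
  · exact alpha_inter_beta hF hsub h0 h1 hx hxw s t ⟨hzα, hzβ⟩
  · have hz := beta_inter_beta' D.toJordanDomain hst hts ⟨hzβ, hzβ'⟩
    simp only [mem_insert_iff, mem_singleton_iff] at hz ⊢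
    rcases hends with ⟨hs, ht⟩ | ⟨hs, ht⟩
    · rcases hz with h | h
      · exact Or.inl (h.trans hs)
      · exact Or.inr (h.trans ht)
    · rcases hz with h | h
      · exact Or.inr (h.trans hs)
      · exact Or.inl (h.trans ht)

/-- **The arc `β` is a simple arc from `P` to `Q`.** [folklore] -/
theorem isSimpleArc_beta {D D' : DobrushinDomain} {F : Set ℝ} {x s t : ℝ} (hst : s < t) (hts : t < s + 1)
    (hends : (D.boundary s = (D'.boundary (sInf (connectedComponentIn F x))) ∧ D.boundary t = (D'.boundary (sSup
        (connectedComponentIn F x)))) ∨ (D.boundary s = (D'.boundary (sSup (connectedComponentIn F x))) ∧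
        D.boundary t = (D'.boundary (sInf (connectedComponentIn F x))))) :
    IsSimpleArc (D.boundary '' Icc s t) (D'.boundary (sInf (connectedComponentIn F x))) (D'.boundary (sSup
        (connectedComponentIn F x))) := by
  have h := D.isSimpleArc_image_boundary hst hts
  rcases hends with ⟨hs, ht⟩ | ⟨hs, ht⟩
  · rwa [hs, ht] at h
  · rw [hs, ht] at h
    exact h.symm

/-- **Near a point of `β` other than `P, Q`, the domain `D` coincides with the defect side.** [folklore] -/
theorem side_nhds {D D' : DobrushinDomain} {F : Set ℝ} (hF : F = {θ : ℝ | D'.boundary θ ∈ D.carrier})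
    (hsub : D'.carrier ⊆ D.carrier) (h0 : D'.pt 0 = D.pt 0) (h1 : D'.pt 1 = D.pt 1) {x : ℝ} (hx : x ∈ F)
    (hxw : x ∈ Ioo (D'.mark 0) (D'.mark 0 + 1)) {U U' : Set ℂ} {s t : ℝ} (hts : t < s + 1) (hunion : U ∪ U' =
        D.carrier \ (D'.boundary '' Icc (sInf (connectedComponentIn F x)) (sSup (connectedComponentIn F x))))
    (hfrU' : frontier U' = (D'.boundary '' Icc (sInf (connectedComponentIn F x)) (sSup (connectedComponentIn F
        x))) ∪ D.boundary '' Icc t (s + 1))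
    (hends : (D.boundary s = (D'.boundary (sInf (connectedComponentIn F x))) ∧ D.boundary t = (D'.boundary (sSup
        (connectedComponentIn F x)))) ∨ (D.boundary s = (D'.boundary (sSup (connectedComponentIn F x))) ∧
        D.boundary t = (D'.boundary (sInf (connectedComponentIn F x)))))
    {p : ℂ} (hp : p ∈ D.boundary '' Icc s t) (hpP : p ≠ (D'.boundary (sInf (connectedComponentIn F x)))) (hpQ : p
        ≠ (D'.boundary (sSup (connectedComponentIn F x)))) :
    ∃ O ∈ 𝓝 p, O ∩ D.carrier ⊆ U := by
  obtain ⟨u, hu, rfl⟩ := hp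
  have hne_s : D.boundary u ≠ D.boundary s := fun h ↦ by
    rcases hends with ⟨hs, -⟩ | ⟨hs, -⟩
    · exact hpP (h.trans hs)
    · exact hpQ (h.trans hs)
  have hne_t : D.boundary u ≠ D.boundary t := fun h ↦ by
    rcases hends with ⟨-, ht⟩ | ⟨-, ht⟩
    · exact hpQ (h.trans ht)
    · exact hpP (h.trans ht)
  have hut : u < t := lt_of_le_of_ne hu.2 fun h ↦ hne_t (by rw [h])
  -- `p ∉ closure U'`
  have hpcl : D.boundary u ∉ closure U' := by
    rw [closure_eq_self_union_frontier, hfrU']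
    rintro (hpU' | hpα | ⟨v, hv, hvu⟩)
    · exact D.toJordanDomain.boundary_notMem_carrier u
        ((hunion ▸ Or.inr hpU' : D.boundary u ∈ D.carrier \ (D'.boundary '' Icc (sInf (connectedComponentIn F x))
            (sSup (connectedComponentIn F x))))).1
    · have := alpha_inter_beta hF hsub h0 h1 hx hxw s t ⟨hpα, ⟨u, hu, rfl⟩⟩
      simp only [mem_insert_iff, mem_singleton_iff] at this
      rcases this with h | h
      · exact hpP h
      · exact hpQ h
    · rcases hv.2.lt_or_eq with hlt | heq
      · have := D.injOn_boundary_Ico s ⟨hu.1, by linarith⟩ ⟨by linarith [hv.1, hu.1, hut], hlt⟩ hvu.symm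
        linarith [hv.1]
      · apply hne_s
        rw [← hvu, heq]
        exact D.periodic_boundary s
  refine ⟨(closure U')ᶜ, isClosed_closure.isOpen_compl.mem_nhds hpcl, ?_⟩
  rintro z ⟨hzcl, hzD⟩
  have hzα : z ∉ (D'.boundary '' Icc (sInf (connectedComponentIn F x)) (sSup (connectedComponentIn F x))) := fun
      h ↦ hzcl (by
    rw [closure_eq_self_union_frontier, hfrU']
    exact Or.inr (Or.inl h))
  have hz : z ∈ U ∪ U' := by rw [hunion]; exact ⟨hzD, hzα⟩
  exact hz.resolve_right fun h ↦ hzcl (subset_closure h)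

/-! ### Two free arcs -/

/-- **Defect sides of distinct free arcs are disjoint**; indeed the defect side of `y` lies in the `D'`-side
of `x`. [folklore] -/
theorem sides_disjoint {D D' : DobrushinDomain} {F : Set ℝ} (hF : F = {θ : ℝ | D'.boundary θ ∈ D.carrier})
    (hsub : D'.carrier ⊆ D.carrier) (h0 : D'.pt 0 = D.pt 0) (h1 : D'.pt 1 = D.pt 1) {x : ℝ} (hx : x ∈ F)
    (hxw : x ∈ Ioo (D'.mark 0) (D'.mark 0 + 1)) {U U' : Set ℂ} {s t : ℝ} (hUo : IsOpen U) (hU'o : IsOpen U')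
    (hdisj : Disjoint U U') (hunion : U ∪ U' = D.carrier \ (D'.boundary '' Icc (sInf (connectedComponentIn F x))
        (sSup (connectedComponentIn F x)))) (hfrU : frontier U = (D'.boundary '' Icc (sInf (connectedComponentIn
        F x)) (sSup (connectedComponentIn F x))) ∪ D.boundary '' Icc s t)
    (hD'U : D'.carrier ⊆ U') (hUc : IsConnected U) {y : ℝ} (hy : y ∈ F)
    (hyw : y ∈ Ioo (D'.mark 0) (D'.mark 0 + 1)) (hne : connectedComponentIn F x ≠ connectedComponentIn F y)
    {V V' : Set ℂ} (hVo : IsOpen V) (hV'o : IsOpen V') (hVc : IsConnected V) (hdisjV : Disjoint V V')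
    (hunionV : V ∪ V' = D.carrier \ (D'.boundary '' Icc (sInf (connectedComponentIn F y)) (sSup
        (connectedComponentIn F y)))) (hD'V : D'.carrier ⊆ V') : Disjoint U V := by
  -- free arcs lie in `closure D'`, which both defect sides miss
  have hαcl : ∀ z : ℝ, D'.boundary z ∈ closure D'.carrier := fun z ↦
    frontier_subset_closure (D'.boundary_mem_frontier z)
  have hUcl := side_inter_closure hUo hdisj hD'U
  have hVcl := side_inter_closure hVo hdisjV hD'V
  have hVsub : V ⊆ U ∪ U' := by
    rw [hunion]
    refine fun z hz ↦ ⟨side_subset hunionV hz, ?_⟩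
    rintro ⟨θ, -, rfl⟩
    have : D'.boundary θ ∈ V ∩ closure D'.carrier := ⟨hz, hαcl θ⟩
    rw [hVcl] at this
    exact this
  have hUsub : U ⊆ V ∪ V' := by
    rw [hunionV]
    refine fun z hz ↦ ⟨side_subset hunion hz, ?_⟩
    rintro ⟨θ, -, rfl⟩
    have : D'.boundary θ ∈ U ∩ closure D'.carrier := ⟨hz, hαcl θ⟩
    rw [hUcl] at this
    exact this
  rcases hVc.isPreconnected.subset_or_subset hUo hU'o hdisj hVsub with hVU | hVU'
  · exfalso
    rcases hUc.isPreconnected.subset_or_subset hVo hV'o hdisjV hUsub with hUV | hUV'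
    · -- `U = V`: compare frontiers at the free point `D'.boundary x`
      have hUV_eq : U = V := Subset.antisymm hUV hVU
      obtain ⟨-, -, -, -, -, hix, hxs, -⟩ := free_component hF h0 h1 hx hxw
      have hxfr : D'.boundary x ∈ frontier U := by
        rw [hfrU]; exact Or.inl ⟨x, ⟨hix.le, hxs.le⟩, rfl⟩
      have hxD : D'.boundary x ∈ D.carrier := (mem_free_iff hF x).1 hx
      have hxfr' : D'.boundary x ∈ frontier V := hUV_eq ▸ hxfr
      have hfrVsub : frontier V ⊆ closure V := frontier_subset_closure
      -- `frontier V ⊆ (D \ V \ V')ᶜ`-type argument: a frontier point of `V` in `D` lies on `ᾱy`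
      have hxαy : D'.boundary x ∈ (D'.boundary '' Icc (sInf (connectedComponentIn F y)) (sSup
          (connectedComponentIn F y))) := by
        have hcl : D'.boundary x ∈ closure V := hfrVsub hxfr'
        have hnotV : D'.boundary x ∉ V := fun h ↦ by
          have := hxfr'.2
          rw [hVo.interior_eq] at this
          exact this h
        have hnotV' : D'.boundary x ∉ V' := fun h ↦
          Set.disjoint_left.1 (hdisjV.symm.closure_right hV'o) h hcl
        by_contra hnot
        have : D'.boundary x ∈ V ∪ V' := by rw [hunionV]; exact ⟨hxD, hnot⟩
        exact this.elim hnotV hnotV'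
      have hmem := free_arcs_inter hF h0 h1 hy hyw hx hxw (Ne.symm hne) ⟨hxαy, ⟨x, ⟨hix.le, hxs.le⟩, rfl⟩⟩
      obtain ⟨-, -, hPD, hQD, -⟩ := free_endpoints hF hsub h0 h1 hy hyw
      simp only [mem_insert_iff, mem_singleton_iff] at hmem
      rcases hmem with h | h
      · exact hPD (h ▸ hxD)
      · exact hQD (h ▸ hxD)
    · obtain ⟨z, hz⟩ := hVc.nonempty
      exact Set.disjoint_left.1 hdisjV hz (hUV' (hVU hz))
  · exact Set.disjoint_left.2 fun z hzU hzV ↦ Set.disjoint_left.1 hdisj hzU (hVU' hzV)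

/-- **Closures of the defect sides of distinct free arcs meet at most in `{P, Q}`.** [folklore] -/
theorem closure_sides_inter {D D' : DobrushinDomain} {F : Set ℝ} (hF : F = {θ : ℝ | D'.boundary θ ∈ D.carrier})
    (hsub : D'.carrier ⊆ D.carrier) (h0 : D'.pt 0 = D.pt 0) (h1 : D'.pt 1 = D.pt 1) {x : ℝ} (hx : x ∈ F)
    (hxw : x ∈ Ioo (D'.mark 0) (D'.mark 0 + 1)) {U U' : Set ℂ} {s t : ℝ} (hst : s < t) (hts : t < s + 1)
    (hUo : IsOpen U) (hU'o : IsOpen U') (hdisj : Disjoint U U') (hunion : U ∪ U' = D.carrier \ (D'.boundary ''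
        Icc (sInf (connectedComponentIn F x)) (sSup (connectedComponentIn F x))))
    (hfrU : frontier U = (D'.boundary '' Icc (sInf (connectedComponentIn F x)) (sSup (connectedComponentIn F x)))
        ∪ D.boundary '' Icc s t) (hfrU' : frontier U' = (D'.boundary '' Icc (sInf (connectedComponentIn F x))
        (sSup (connectedComponentIn F x))) ∪ D.boundary '' Icc t (s + 1))
    (hD'U : D'.carrier ⊆ U')
    (hends : (D.boundary s = (D'.boundary (sInf (connectedComponentIn F x))) ∧ D.boundary t = (D'.boundary (sSup
        (connectedComponentIn F x)))) ∨ (D.boundary s = (D'.boundary (sSup (connectedComponentIn F x))) ∧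
        D.boundary t = (D'.boundary (sInf (connectedComponentIn F x)))))
    (hUc : IsConnected U) {y : ℝ} (hy : y ∈ F) (hyw : y ∈ Ioo (D'.mark 0) (D'.mark 0 + 1))
    (hne : connectedComponentIn F x ≠ connectedComponentIn F y) {V V' : Set ℂ} {s' t' : ℝ}
    (hts' : t' < s' + 1) (hVo : IsOpen V) (hV'o : IsOpen V') (hVc : IsConnected V) (hdisjV : Disjoint V V')
    (hunionV : V ∪ V' = D.carrier \ (D'.boundary '' Icc (sInf (connectedComponentIn F y)) (sSup
        (connectedComponentIn F y)))) (hfrV : frontier V = (D'.boundary '' Icc (sInf (connectedComponentIn F y))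
        (sSup (connectedComponentIn F y))) ∪ D.boundary '' Icc s' t')
    (hfrV' : frontier V' = (D'.boundary '' Icc (sInf (connectedComponentIn F y)) (sSup (connectedComponentIn F
        y))) ∪ D.boundary '' Icc t' (s' + 1)) (hD'V : D'.carrier ⊆ V')
    (hendsV : (D.boundary s' = (D'.boundary (sInf (connectedComponentIn F y))) ∧ D.boundary t' = (D'.boundary
        (sSup (connectedComponentIn F y)))) ∨ (D.boundary s' = (D'.boundary (sSup (connectedComponentIn F y))) ∧
        D.boundary t' = (D'.boundary (sInf (connectedComponentIn F y))))) :
    closure U ∩ closure V ⊆ ({(D'.boundary (sInf (connectedComponentIn F x))), (D'.boundary (sSup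
        (connectedComponentIn F x)))} : Set ℂ) := by
  have hUV : Disjoint U V := sides_disjoint hF hsub h0 h1 hx hxw hUo hU'o hdisj hunion hfrU hD'U hUc hy hyw hne
    hVo hV'o hVc hdisjV hunionV hD'V
  have hαcl : ∀ z : ℝ, D'.boundary z ∈ closure D'.carrier := fun z ↦
    frontier_subset_closure (D'.boundary_mem_frontier z)
  have hVcl := side_inter_closure hVo hdisjV hD'V
  rintro z ⟨hzU, hzV⟩
  rw [closure_eq_self_union_frontier, hfrU] at hzU
  rcases hzU with hzU | hzα | hzβ
  · exact absurd hzV (Set.disjoint_left.1 (hUV.closure_right hUo) hzU)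
  · rw [closure_eq_self_union_frontier, hfrV] at hzV
    rcases hzV with hzV | hzαy | ⟨u, -, rfl⟩
    · obtain ⟨θ, -, rfl⟩ := hzα
      have : D'.boundary θ ∈ V ∩ closure D'.carrier := ⟨hzV, hαcl θ⟩
      rw [hVcl] at this
      exact this.elim
    · exact free_arcs_inter hF h0 h1 hx hxw hy hyw hne ⟨hzα, hzαy⟩
    · by_contra hzn
      exact D.toJordanDomain.boundary_notMem_carrier u
        ((free_isCrosscut hF hsub h0 h1 hx hxw).2.2.2.2 ⟨hzα, hzn⟩)
  · by_contra hzn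
    have hzP : z ≠ (D'.boundary (sInf (connectedComponentIn F x))) := fun h ↦ hzn (Or.inl h)
    have hzQ : z ≠ (D'.boundary (sSup (connectedComponentIn F x))) := fun h ↦ hzn (Or.inr h)
    rw [closure_eq_self_union_frontier, hfrV] at hzV
    rcases hzV with hzV | hzαy | hzβy
    · obtain ⟨u, -, rfl⟩ := hzβ
      exact D.toJordanDomain.boundary_notMem_carrier u (side_subset hunionV hzV)
    · obtain ⟨θ, -, rfl⟩ := hzαy
      exact hzn (beta_inter_closure hF hsub h0 h1 hx hxw hst hts hunion hfrU' hD'U hends ⟨hzβ, hαcl θ⟩)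
    · by_cases hzy : z = (D'.boundary (sInf (connectedComponentIn F y))) ∨ z = (D'.boundary (sSup
        (connectedComponentIn F y)))
      · have hzcl : z ∈ closure D'.carrier := by
          rcases hzy with h | h <;> rw [h] <;> exact hαcl _
        exact hzn (beta_inter_closure hF hsub h0 h1 hx hxw hst hts hunion hfrU' hD'U hends ⟨hzβ, hzcl⟩)
      · simp only [not_or] at hzy
        obtain ⟨O, hO, hOU⟩ := side_nhds hF hsub h0 h1 hx hxw hts hunion hfrU' hends hzβ hzP hzQ
        obtain ⟨O', hO', hO'V⟩ := side_nhds hF hsub h0 h1 hy hyw hts' hunionV hfrV' hendsV hzβy hzy.1 hzy.2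
        obtain ⟨u, -, rfl⟩ := hzβ
        have hcl : D.boundary u ∈ closure D.carrier := frontier_subset_closure (D.boundary_mem_frontier u)
        obtain ⟨q, hqO, hqD⟩ := mem_closure_iff_nhds.1 hcl (O ∩ O') (inter_mem hO hO')
        exact Set.disjoint_left.1 hUV (hOU ⟨hqO.1, hqD⟩) (hO'V ⟨hqO.2, hqD⟩)

/-- **Registered helper stub `stub_radoSides`** (towards `stub_radoSqueezeFamily`, line `birth`): the two sides
of a closed free arc (Newman), in closed form. [cite: Newman1939, Ch. V §11] -/
theorem stub_radoSides :
    ∀ (D D' : DobrushinDomain) (F : Set ℝ), F = {θ : ℝ | D'.boundary θ ∈ D.carrier} →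
      D'.carrier ⊆ D.carrier → D'.pt 0 = D.pt 0 → D'.pt 1 = D.pt 1 → ∀ x : ℝ, x ∈ F →
      x ∈ Set.Ioo (D'.mark 0) (D'.mark 0 + 1) →
      ∃ (U U' : Set ℂ) (s t : ℝ), s < t ∧ t < s + 1 ∧ IsOpen U ∧ IsOpen U' ∧ IsConnected U ∧
        IsConnected U' ∧ Disjoint U U' ∧
        U ∪ U' = D.carrier \ D'.boundary '' Set.Icc (sInf (connectedComponentIn F x)) (sSup (connectedComponentIn
            F x)) ∧
        D'.carrier ⊆ U' := by
  intro D D' F hF hsub h0 h1 x hx hxw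
  obtain ⟨U, U', s, t, hst, hts, hUo, hU'o, hUc, hU'c, hdisj, hunion, -, -, hD'U, -⟩ :=
    exists_sides hF hsub h0 h1 hx hxw
  exact ⟨U, U', s, t, hst, hts, hUo, hU'o, hUc, hU'c, hdisj, hunion, hD'U⟩

end Sides

end Summit.CriticalPhenomena.SAWScalingLimit.Theorems.RestrictionOfLimit.Birth

end
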